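import Mathlib

/-!
# Dixmier's lemma: Schur for simple modules of countable dimension

Blind cell `pub-hodge-repro2`, seat p8 (gen 5), Tier-5 kernel support.  This file kernel-checks
the purely algebraic content of the step «Schur's lemma for the irreducible representation ρ»
which the record (route/T5-N3-route-2.md §N3.12.4 steps (s2)–(s3) for the archimedean
(𝔤,K)-module side, MVW chap. 2 III.5 for the p-adic side, as re-derived in
route/T5-CHECK-N3-p8.md v5 §9) uses in the form

  every `A`-linear endomorphism of an irreducible ρ is a scalar.

The landed file `T5SchurTensor` (p391579) TAKES this as the hypothesis
`∀ φ : M →ₗ[S] M, ∃ c : k, ∀ x, φ x = c • x`; this file PROVES it under the two hypotheses that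
the record discharges in prose:

* the scalar field `k` is algebraically closed and uncountable (`k = ℂ`), and
* the module `M` has countable dimension over `k` (`Module.rank k M ≤ ℵ₀`).

The argument is Dixmier's: by Schur (Mathlib's `Module.End.instDivisionRing`) the endomorphism
ring `D = End_A(M)` is a division ring; evaluation at a non-zero vector embeds `D` `k`-linearly
into `M`, so `rank_k D ≤ rank_k M ≤ ℵ₀`; if some `φ ∈ D` were transcendental over `k`, the family
`c ↦ (φ - c)⁻¹` (`c ∈ k`) would be `k`-linearly independent (partial fractions), forcing
`#k ≤ rank_k D`, impossible for uncountable `k`; so every `φ` is algebraic, and over an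
algebraically closed field an algebraic element of a division ring is a scalar (its minimal
polynomial is irreducible, hence of degree one).

What stays prose (hypotheses of the theorems below, discharged on the record): that an irreducible
smooth representation of a p-adic group (countable basis of open compact subgroups, hence
`V = ⋃_K V^K` with each `V^K` of countable dimension) and an irreducible admissible
`(𝔤,K)`-module (finitely many copies of each of the countably many `K`-types) have countable
dimension over `ℂ`; the feeder `rank_le_aleph0_of_countable_span` turns a countable spanning set
into the hypothesis `Module.rank k M ≤ ℵ₀`.

README §8(d): uses an L-value-free non-vanishing device: NO (pure algebra; no non-vanishing
statement of any kind is asserted).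
-/

namespace Summit.Ventures.HodgeRepro2.T5DixmierSchur

open Polynomial Cardinal

universe u v

section DivisionRing

variable {k : Type u} {D : Type v} [Field k] [DivisionRing D] [Algebra k D]

/-- A transcendental element differs from every scalar: `φ - c ≠ 0` for all `c : k`. -/
theorem sub_algebraMap_ne_zero {φ : D} (hφ : Transcendental k φ) (c : k) :
    φ - algebraMap k D c ≠ 0 := by
  intro h
  apply hφ
  rw [sub_eq_zero.mp h]
  exact isAlgebraic_algebraMap c

/-- Partial-fraction identity: multiplying `(φ - c_i)⁻¹` by `∏_{j ∈ s} (φ - c_j)` leaves the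
product over `s.erase i` (for `i ∈ s`, `φ` transcendental so that `φ - c_i` is invertible). -/
theorem aeval_prod_mul_inv [DecidableEq k] {φ : D} (hφ : Transcendental k φ) (s : Finset k)
    {i : k} (hi : i ∈ s) :
    aeval φ (∏ j ∈ s, (X - C j : k[X])) * (φ - algebraMap k D i)⁻¹ =
      aeval φ (∏ j ∈ s.erase i, (X - C j : k[X])) := by
  have hP : (∏ j ∈ s, (X - C j)) = (∏ j ∈ s.erase i, (X - C j)) * (X - C i) :=
    (Finset.prod_erase_mul s _ hi).symm
  rw [hP, map_mul, map_sub, aeval_X, aeval_C, mul_assoc,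
    mul_inv_cancel₀ (sub_algebraMap_ne_zero hφ i), mul_one]

/-- Evaluating `∏_{j ∈ s.erase c} (X - C j)` at a point `i ∈ s` different from `c` gives `0`. -/
theorem eval_prod_erase_eq_zero [DecidableEq k] (s : Finset k) {c i : k} (hi : i ∈ s)
    (hci : c ≠ i) : eval i (∏ j ∈ s.erase c, (X - C j : k[X])) = 0 := by
  rw [eval_prod]
  exact Finset.prod_eq_zero (Finset.mem_erase.mpr ⟨hci.symm, hi⟩) (by simp)

/-- Evaluating `∏_{j ∈ s.erase i} (X - C j)` at `i` itself gives a non-zero value. -/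
theorem eval_prod_erase_ne_zero [DecidableEq k] (s : Finset k) (i : k) :
    eval i (∏ j ∈ s.erase i, (X - C j : k[X])) ≠ 0 := by
  rw [eval_prod]
  refine Finset.prod_ne_zero_iff.mpr fun j hj => ?_
  rw [eval_sub, eval_X, eval_C]
  exact sub_ne_zero.mpr (Finset.ne_of_mem_erase hj).symm

/-- **Partial fractions.** If `φ` is transcendental over `k`, the family `c ↦ (φ - c)⁻¹`
indexed by `c ∈ k` is `k`-linearly independent in the division ring `D`. -/
theorem linearIndependent_inv_sub {φ : D} (hφ : Transcendental k φ) :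
    LinearIndependent k (fun c : k => (φ - algebraMap k D c)⁻¹) := by
  classical
  rw [linearIndependent_iff']
  intro s g hsum i hi
  -- multiply the relation by `P(φ)`, `P = ∏_{j ∈ s} (X - C j)`
  have h1 : ∑ c ∈ s, g c • aeval φ (∏ j ∈ s.erase c, (X - C j : k[X])) = 0 := by
    have h0 : aeval φ (∏ j ∈ s, (X - C j : k[X])) *
        ∑ c ∈ s, g c • (φ - algebraMap k D c)⁻¹ = 0 := by
      rw [hsum, mul_zero]
    rw [Finset.mul_sum] at h0
    rw [← h0]
    refine Finset.sum_congr rfl fun c hc => ?_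
    rw [mul_smul_comm, aeval_prod_mul_inv hφ s hc]
  -- pull the relation back to `k[X]` along the injective map `aeval φ`
  have h2 : ∑ c ∈ s, g c • (∏ j ∈ s.erase c, (X - C j : k[X])) = 0 := by
    apply transcendental_iff_injective.mp hφ
    rw [map_sum, map_zero]
    simpa only [map_smul] using h1
  -- evaluate at `i`
  have h3 := congrArg (Polynomial.eval i) h2
  rw [eval_finsetSum, eval_zero, Finset.sum_eq_single i] at h3
  · rw [eval_smul, smul_eq_mul] at h3
    exact (mul_eq_zero.mp h3).resolve_right (eval_prod_erase_ne_zero s i)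
  · intro c hc hci
    rw [eval_smul, eval_prod_erase_eq_zero s hi hci, smul_zero]
  · intro h
    exact absurd hi h

/-- A transcendental element forces `#k ≤ rank_k D` (universe-polymorphic form). -/
theorem lift_mk_le_lift_rank_of_transcendental {φ : D} (hφ : Transcendental k φ) :
    Cardinal.lift.{v} (#k) ≤ Cardinal.lift.{u} (Module.rank k D) :=
  (linearIndependent_inv_sub hφ).cardinal_lift_le_rank

/-- **Dixmier's lemma, algebraic half.** Over an uncountable field `k`, every element of a
division ring `D` of countable `k`-dimension is algebraic over `k`. -/
theorem isAlgebraic_of_rank_le_aleph0 (hk : ℵ₀ < #k) (hD : Module.rank k D ≤ ℵ₀) (φ : D) :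
    IsAlgebraic k φ := by
  by_contra hφ
  have h1 := lift_mk_le_lift_rank_of_transcendental (k := k) (D := D) hφ
  have h2 : Cardinal.lift.{u} (Module.rank k D) ≤ ℵ₀ := by
    calc Cardinal.lift.{u} (Module.rank k D) ≤ Cardinal.lift.{u} ℵ₀ := lift_le.mpr hD
      _ = ℵ₀ := lift_aleph0
  have h3 : ℵ₀ < Cardinal.lift.{v} (#k) := aleph0_lt_lift.mpr hk
  exact absurd (h1.trans h2) (not_le.mpr h3)

/-- **Dixmier's lemma.** Over an uncountable algebraically closed field `k`, a division ring of
countable `k`-dimension is `k` itself: every element is a scalar. -/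
theorem exists_algebraMap_eq [IsAlgClosed k] (hk : ℵ₀ < #k) (hD : Module.rank k D ≤ ℵ₀)
    (φ : D) : ∃ c : k, algebraMap k D c = φ := by
  have hint : IsIntegral k φ := (isAlgebraic_of_rank_le_aleph0 hk hD φ).isIntegral
  have h1 : (minpoly k φ).degree = 1 :=
    IsAlgClosed.degree_eq_one_of_irreducible k (minpoly.irreducible hint)
  exact RingHom.mem_range.mp (minpoly.degree_eq_one_iff.mp h1)

end DivisionRing

section Module

variable {k A M : Type*} [Field k] [Ring A] [Algebra k A] [AddCommGroup M] [Module A M]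
  [Module k M] [IsScalarTower k A M]

/-- Evaluation at a vector `m`, as a `k`-linear map `End_A(M) → M`. -/
def evalAt (m : M) : Module.End A M →ₗ[k] M where
  toFun φ := φ m
  map_add' _ _ := rfl
  map_smul' c φ := LinearMap.smul_apply c φ m

/-- `evalAt m φ = φ m`. -/
@[simp] theorem evalAt_apply (m : M) (φ : Module.End A M) : evalAt (k := k) m φ = φ m := rfl

/-- On a simple module, evaluation at a non-zero vector is injective on endomorphisms
(Schur: a non-zero endomorphism is bijective). -/
theorem evalAt_injective [IsSimpleModule A M] {m : M} (hm : m ≠ 0) :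
    Function.Injective (evalAt (k := k) (A := A) m) := by
  intro φ ψ h
  have h0 : (φ - ψ) m = 0 := by
    rw [LinearMap.sub_apply, sub_eq_zero]
    exact h
  rcases LinearMap.bijective_or_eq_zero (φ - ψ) with hb | hz
  · exact absurd (hb.injective (h0.trans (map_zero (φ - ψ)).symm)) hm
  · exact sub_eq_zero.mp hz

/-- The endomorphism ring of a simple module has `k`-rank at most that of the module. -/
theorem rank_end_le [IsSimpleModule A M] :
    Module.rank k (Module.End A M) ≤ Module.rank k M := by
  have := IsSimpleModule.nontrivial A M
  obtain ⟨m, hm⟩ := exists_ne (0 : M)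
  exact (evalAt (k := k) m).rank_le_of_injective (evalAt_injective hm)

/-- **Schur's lemma, Dixmier form.** Let `A` be a `k`-algebra over an uncountable algebraically
closed field `k` and `M` a simple `A`-module of countable `k`-dimension.  Then every `A`-linear
endomorphism of `M` is multiplication by a scalar `c ∈ k`.  This is exactly the hypothesis
`∀ φ : M →ₗ[S] M, ∃ c : k, ∀ x, φ x = c • x` of `T5SchurTensor.exists_fun`. -/
theorem exists_smul_eq [IsAlgClosed k] [IsSimpleModule A M] (hk : ℵ₀ < #k)
    (hM : Module.rank k M ≤ ℵ₀) (φ : Module.End A M) : ∃ c : k, ∀ x, φ x = c • x := by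
  classical
  have hD : Module.rank k (Module.End A M) ≤ ℵ₀ := (rank_end_le (k := k)).trans hM
  obtain ⟨c, hc⟩ := exists_algebraMap_eq hk hD φ
  exact ⟨c, fun x => by rw [← hc, Module.algebraMap_end_apply]⟩

/-- The endomorphism ring of such a module is spanned by the identity: every endomorphism is
`c • id`. -/
theorem eq_smul_id [IsAlgClosed k] [IsSimpleModule A M] (hk : ℵ₀ < #k)
    (hM : Module.rank k M ≤ ℵ₀) (φ : Module.End A M) : ∃ c : k, φ = c • LinearMap.id := by
  obtain ⟨c, hc⟩ := exists_smul_eq hk hM φ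
  exact ⟨c, LinearMap.ext fun x => by rw [hc x, LinearMap.smul_apply, LinearMap.id_apply]⟩

/-- A countable spanning set gives countable rank. -/
theorem rank_le_aleph0_of_countable_span {s : Set M} (hs : s.Countable)
    (hspan : Submodule.span k s = ⊤) : Module.rank k M ≤ ℵ₀ := by
  have h1 : Module.rank k (Submodule.span k s) ≤ #s := rank_span_le s
  rw [hspan, rank_top] at h1
  exact h1.trans (Cardinal.mk_le_aleph0_iff.mpr hs.to_subtype)

/-- A countably indexed spanning family gives countable rank. -/
theorem rank_le_aleph0_of_countable_family {ι : Type*} [Countable ι] (v : ι → M)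
    (hv : Submodule.span k (Set.range v) = ⊤) : Module.rank k M ≤ ℵ₀ :=
  rank_le_aleph0_of_countable_span (Set.countable_range v) hv

end Module

section Complex

variable {A M : Type*} [Ring A] [Algebra ℂ A] [AddCommGroup M] [Module A M] [Module ℂ M]
  [IsScalarTower ℂ A M]

/-- `ℂ` is uncountable: `ℵ₀ < #ℂ`. -/
theorem aleph0_lt_mk_complex : ℵ₀ < #ℂ := by
  rw [Cardinal.mk_complex]
  exact Cardinal.aleph0_lt_continuum

/-- **Schur over `ℂ`.** A simple `A`-module of countable `ℂ`-dimension (`A` a `ℂ`-algebra) has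
only scalar endomorphisms. -/
theorem exists_smul_eq_complex [IsSimpleModule A M] (hM : Module.rank ℂ M ≤ ℵ₀)
    (φ : Module.End A M) : ∃ c : ℂ, ∀ x, φ x = c • x :=
  exists_smul_eq aleph0_lt_mk_complex hM φ

/-- **Schur over `ℂ`, countable spanning family.** If a simple `A`-module is spanned over `ℂ` by
a countable family, every endomorphism is a scalar. -/
theorem exists_smul_eq_complex_of_countable_family [IsSimpleModule A M] {ι : Type*}
    [Countable ι] (v : ι → M) (hv : Submodule.span ℂ (Set.range v) = ⊤)
    (φ : Module.End A M) : ∃ c : ℂ, ∀ x, φ x = c • x :=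
  exists_smul_eq_complex (rank_le_aleph0_of_countable_family v hv) φ

end Complex

end Summit.Ventures.HodgeRepro2.T5DixmierSchur
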